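/-
Copyright (c) 2026 the pub-hodgecm-mathlib formalisation cell (harness21).  Prover seat hodgecm-mathlib-K2Liu-p09 (g4): Track B «K2-LIT», #184♮ = hLiu418,
Road I organ (A-int)-fin, DEFS brick D-A v1 (LEAD F0P6-plan (g12) RULING «M-156g» (2); dealer K2E5-plan (g5) SIGS-RoadI-v3 §A-int; heads
`K2/K2Liu-p09/g4/HEADS-DA-LocalSWSectionDefs.K2Liu-p09-g4.md`).
-/
import Literature.NumberTheory.K2Lit.DoubledTensorEmbedding                        -- ★ `tensorFrame`, `epsD`, `hermD_tensor`, adelic `tensorEmb`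
import Literature.NumberTheory.GelbartRogawski1991.LocalDoubledKroneckerEmbedding   -- ★ `kronOneInl` (generic local `h ↦ h ⊗ₖ 1`)
import Literature.NumberTheory.GelbartRogawski1991.LocalUnitarySplittingDatum       -- ★ `localSchrodinger`, `LocalMp`, `LocalSplittingDatum.localOmega`
import HarnessLib

/-!
# Crux `HLiu418`, Track B road `K2_Liu`, Road I organ (A-int)-fin — DEFS brick D-A v1: THE LOCAL SIEGEL–WEIL SECTION AT A FINITE PLACE
# and the local tensor embedding `U(𝔻)(L⁺_v) → U(𝔻 ⊗ V′)(L⁺_v)`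

Cell `hodgecm-mathlib`, crux item hLiu418 = `stmt-HodgeConjecture-24832`, route of record `HCCMUnconditional`; squad K2 ∕ K2Liu, prover K2Liu-p09 (g4);
definition lane (`--kind definition`), `--supports stmt-HodgeConjecture-24832 --as helper`.  DEFINITIONS WITH BODIES + unfolding theorems; no instance, no
notation, no named fact, no `sorry`.

The Road I sheet (SIGS-RoadI-v3 §A-int, §U4, §U1) needs, at a finite place `v` of `L⁺`, the place factor of the adelic Siegel–Weil section ★
`swSection sD Φ h = (ω(r_Δ · sD h) Φ)(0)` (`K2Lit/SiegelWeilSectionLine.lean`) and of its pull-back ★ `swSectionTensor = swSection ∘ tensorEmb` to the doubled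
group of `V` along `h ↦ h ⊗ 1_{V′}` (`K2Lit/DoubledTensorEmbedding.lean`).  Both have local carriers in tree already — ★ `kronOneInl` (the generic local
`h ↦ h ⊗ₖ 1`, [MoeglinVignerasWaldspurger1987, Chap. 1 I.17]) and the `Δ`-functional `Φ ↦ (ω(m₀ · s h) Φ)(0)` of a local doubled Weil datum
`s : U(𝔻)(L⁺_v) →* S̃p_ψ(𝕎^𝔻_v)` on ★ `SchwartzBruhat (Fin N → L⁺_v)` (★ `LocalSplittingDatum.localOmega`; its Siegel eigen-law is ★
`apply_zero_toRep_mul_localSplitting_eq_mul`, [Kudla1994, Thm 3.1]) — this file only NAMES them: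
* §1 `tensorEmbLoc` — `U(𝔻)(L⁺_v) →* U(𝔻 ⊗ V′)(L⁺_v)`, `h ↦ reindex epsD (h ⊗ₖ 1_{V′})` (★ `kronOneInl` at `e := epsD`, read on `U(J^{𝔻⊗V′})` along ★
  `hermD_tensor`), its matrix (`coe_tensorEmbLoc_apply`, `rfl`) and continuity.
* §2 `swSectionLoc s m₀ Φ h := (ω(m₀ · s h) Φ)(0)` — the LOCAL SIEGEL–WEIL SECTION of a local doubled Weil datum `(s, m₀)` (GENERIC in `(s, m₀)`, exactly as the
  adelic ★ `swSection sD`; `m₀` = Rao's `r(δ′)` carrying `ℓ_Δ` onto `ℓ_Y`), linear in `Φ`, with the right-translation law `f_Φ(h k) = f_{ω(s k)Φ}(h)`.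
* §3 `swSectionTensorLoc := swSectionLoc ∘ tensorEmbLoc` — the `V′`-Siegel–Weil section on `U(𝔻)(L⁺_v)` (local twin of ★ `swSectionTensor`), `rfl` bridge and
  translation law.
NOT here (next brick D-A′, after SIGS v3.6 pins the normalisation): the Kudla–Rallis mixed-model map `r_v : 𝒮(V′_v^{⊕n}) → 𝒮(a′_v^{⊕n})`, which needs a
generic fibre-integral on `SchwartzBruhat (Fin N → F_v)` first.

HONEST LABEL: HC_CM is proved only modulo the printed citations (2 remaining named inputs: hLiu418 = stmt-HodgeConjecture-24832,
h413 = stmt-HodgeConjecture-24833) until rung 0 closes; this file defines carriers and closes no item.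
References: [KudlaRallis1994] §1; [Kudla1994] §2, §3 Thm. 3.1; [HarrisKudlaSweet1996] §1 (1.8), (1.15)–(1.16); [MoeglinVignerasWaldspurger1987] Chap. 1 I.17,
Chap. 2 II.1; [GanQiuTakeda2014] §5.4 (the map `Φ^{n,r}`, `R_n(V_r)`).
-/

set_option autoImplicit false
set_option linter.dupNamespace false

noncomputable section

open scoped Matrix Kronecker
open NumberField IsDedekindDomain Matrix
open Literature.NumberTheory.Automorphic Literature.NumberTheory.Automorphic.UnitaryGroup
open Literature.NumberTheory.GelbartRogawski1991 Literature.NumberTheory.GelbartRogawski1991.GRConstruction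
open Literature.NumberTheory.GelbartRogawski1991.UnitaryDualPair.LocalSplitting
open Literature.NumberTheory.K2Lit.SiegelDoubled
open Literature.RepresentationTheory.HeisenbergGroup

namespace Summit.HodgeConjecture.HodgeConjecture.Cruxes.HLiu418.K2LiuLocalSWSectionDefs

variable (L : Type) [Field L] [NumberField L] [IsCMField L]
variable {N M n : ℕ} (e : Fin N × Fin M ≃ Fin n)
  (dV : Fin N → L) (hdV : ∀ i, IsCMField.complexConj L (dV i) = dV i)
  (dW : Fin M → L) (hdW : ∀ i, IsCMField.complexConj L (dW i) = dW i)
variable {M₂ M' n' : ℕ} (eW : Fin M × Fin M₂ ≃ Fin M') (e' : Fin N × Fin M' ≃ Fin n')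
  (dV' : Fin M₂ → L) (hdV' : ∀ k, IsCMField.complexConj L (dV' k) = dV' k)

/-! ## §1 The local tensor embedding `h ↦ h ⊗ 1_{V′}` -/

/-- `U(reindex epsD (J^𝔻 ⊗ₖ diag dV′))(L⁺_v) = U(J^{𝔻 ⊗ V′})(L⁺_v)` — the two Gram matrices coincide (★ `hermD_tensor`).
[cite: Kudla1994, §2 (doubled space, Siegel parabolic)] -/
theorem localPi_hermD_tensor_eq (v : HeightOneSpectrum (𝓞 (Fp L))) :
    UnitaryGroup.localPi L (IsCMField.complexConj L) (n' + n')
        (Matrix.reindex (epsD e eW e') (epsD e eW e') (hermD L e dV hdV dW hdW ⊗ₖ Matrix.diagonal dV')) v =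
      UnitaryGroup.localPi L (IsCMField.complexConj L) (n' + n')
        (hermD L e' dV hdV (tensorFrame L dW eW dV') (tensorFrame_real L dW hdW eW dV' hdV')) v := by
  rw [hermD_tensor L e dV hdV dW hdW eW e' dV' hdV']

/-- **`tensorEmbLoc v : U(𝔻)(L⁺_v) →* U(𝔻 ⊗ V′)(L⁺_v)`, `h ↦ reindex epsD (h ⊗ₖ 1_{V′})`** — the place-`v` factor of the adelic ★ `tensorEmb`
(★ `kronOneInl` at `e := epsD e eW e'`, `J_V := J^𝔻`, `J_W := diag dV′`, read on `U(J^{𝔻⊗V′})(L⁺_v)` through `localPi_hermD_tensor_eq`).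
[cite: Kudla1994, §2 (doubled space, Siegel parabolic), §3 Thm. 3.1] [cite: MoeglinVignerasWaldspurger1987, Chap. 1 I.17] -/
def tensorEmbLoc (v : HeightOneSpectrum (𝓞 (Fp L))) :
    UnitaryGroup.localPi L (IsCMField.complexConj L) (n + n) (hermD L e dV hdV dW hdW) v →*
      UnitaryGroup.localPi L (IsCMField.complexConj L) (n' + n')
        (hermD L e' dV hdV (tensorFrame L dW eW dV') (tensorFrame_real L dW hdW eW dV' hdV')) v :=
  (MulEquiv.subgroupCongr (localPi_hermD_tensor_eq L e dV hdV dW hdW eW e' dV' hdV' v)).toMonoidHom.comp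
    (kronOneInl L (n + n) M₂ (epsD e eW e') (IsCMField.complexConj L) (hermD L e dV hdV dW hdW) (Matrix.diagonal dV') v)

/-- underlying family of `tensorEmbLoc v h`: `kronOneGL` of the family of `h` (the `subgroupCongr` cast is the identity on values).
[cite: MoeglinVignerasWaldspurger1987, Chap. 1 I.17] -/
theorem coe_tensorEmbLoc (v : HeightOneSpectrum (𝓞 (Fp L))) (h : UnitaryGroup.localPi L (IsCMField.complexConj L) (n + n) (hermD L e dV hdV dW hdW) v) :
    ((tensorEmbLoc L e dV hdV dW hdW eW e' dV' hdV' v h :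
        UnitaryGroup.localPi L (IsCMField.complexConj L) (n' + n')
          (hermD L e' dV hdV (tensorFrame L dW eW dV') (tensorFrame_real L dW hdW eW dV' hdV')) v) : UnitaryGroup.LocalGLPi L (n' + n') v) =
      kronOneGL L (n + n) M₂ (epsD e eW e') v (h : UnitaryGroup.LocalGLPi L (n + n) v) :=
  rfl

/-- **the matrix of `(tensorEmbLoc v h)_w` is `reindex epsD epsD (h_w ⊗ₖ 1_{V′})`**. [cite: Kudla1994, §2 (doubled space, Siegel parabolic)] -/
theorem coe_tensorEmbLoc_apply (v : HeightOneSpectrum (𝓞 (Fp L))) (h : UnitaryGroup.localPi L (IsCMField.complexConj L) (n + n) (hermD L e dV hdV dW hdW) v)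
    (w : UnitaryGroup.PlacesOver L v) :
    ((((tensorEmbLoc L e dV hdV dW hdW eW e' dV' hdV' v h :
        UnitaryGroup.localPi L (IsCMField.complexConj L) (n' + n')
          (hermD L e' dV hdV (tensorFrame L dW eW dV') (tensorFrame_real L dW hdW eW dV' hdV')) v) : UnitaryGroup.LocalGLPi L (n' + n') v) w :
        GL (Fin (n' + n')) (w.1.adicCompletion L)) : Matrix (Fin (n' + n')) (Fin (n' + n')) (w.1.adicCompletion L)) =
      Matrix.reindex (epsD e eW e') (epsD e eW e')
        ((((h : UnitaryGroup.LocalGLPi L (n + n) v) w : GL (Fin (n + n)) (w.1.adicCompletion L)) : Matrix (Fin (n + n)) (Fin (n + n)) (w.1.adicCompletion L)) ⊗ₖ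
          (1 : Matrix (Fin M₂) (Fin M₂) (w.1.adicCompletion L))) := by
  rw [coe_tensorEmbLoc]
  exact coe_kronOneGL_apply L (n + n) M₂ (epsD e eW e') v (h : UnitaryGroup.LocalGLPi L (n + n) v) w

/-- `tensorEmbLoc v` is continuous. [cite: MoeglinVignerasWaldspurger1987, Chap. 1 I.17] -/
theorem continuous_tensorEmbLoc (v : HeightOneSpectrum (𝓞 (Fp L))) : Continuous (tensorEmbLoc L e dV hdV dW hdW eW e' dV' hdV' v) := by
  refine Topology.IsInducing.subtypeVal.continuous_iff.2 ?_
  exact ((continuous_kronOneGL L (n + n) M₂ (epsD e eW e') v).comp continuous_subtype_val).congr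
    fun h => (coe_tensorEmbLoc L e dV hdV dW hdW eW e' dV' hdV' v h).symm

/-! ## §2 The local Siegel–Weil section of a local doubled Weil datum -/

section SW

variable {Nd : ℕ} {T : Matrix (Fin Nd) (Fin Nd) (Fp L)} {J : Matrix (Fin Nd) (Fin Nd) L}

/-- **THE LOCAL SIEGEL–WEIL SECTION `f_Φ(h) := (ω(m₀ · s h) Φ)(0)`** of a local doubled Weil datum: `s : U(J)(L⁺_v) →* S̃p_ψ(𝕎_v)` a splitting into the
local metaplectic group of pairs of the Schrödinger model `𝒮(L⁺_vᴺ)` (★ `LocalSplittingDatum.localSplitting` for Kudla's data) and `m₀ ∈ S̃p_ψ(𝕎_v)` the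
model change carrying the Siegel Lagrangian `ℓ_Δ` onto `ℓ_Y` (Rao's `r(δ′)`; the adelic ★ `swSection` uses ★ `rDelta`).  GENERIC in `(s, m₀)`, like the adelic
★ `swSection sD`: the Siegel law is a THEOREM about Kudla's datum (★ `apply_zero_toRep_mul_localSplitting_eq_mul`), not part of the definition.
[cite: KudlaRallis1994, §1] [cite: HarrisKudlaSweet1996, §1 (1.8)] [cite: Kudla1994, §3 Thm. 3.1] -/
def swSectionLoc (v : HeightOneSpectrum (𝓞 (Fp L)))
    (s : UnitaryGroup.localPi L (IsCMField.complexConj L) Nd J v →* LocalMp (Fp L) Nd T v) (m₀ : LocalMp (Fp L) Nd T v)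
    (Φ : SchwartzBruhat (Fin Nd → v.adicCompletion (Fp L))) (h : UnitaryGroup.localPi L (IsCMField.complexConj L) Nd J v) : ℂ :=
  ((MpPsi.toRep (localSchrodinger (Fp L) Nd T v) (m₀ * s h) Φ : SchwartzBruhat (Fin Nd → v.adicCompletion (Fp L))) :
    (Fin Nd → v.adicCompletion (Fp L)) → ℂ) 0

/-- unfolding. [cite: KudlaRallis1994, §1] -/
theorem swSectionLoc_apply (v : HeightOneSpectrum (𝓞 (Fp L)))
    (s : UnitaryGroup.localPi L (IsCMField.complexConj L) Nd J v →* LocalMp (Fp L) Nd T v) (m₀ : LocalMp (Fp L) Nd T v)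
    (Φ : SchwartzBruhat (Fin Nd → v.adicCompletion (Fp L))) (h : UnitaryGroup.localPi L (IsCMField.complexConj L) Nd J v) :
    swSectionLoc L v s m₀ Φ h =
      ((MpPsi.toRep (localSchrodinger (Fp L) Nd T v) (m₀ * s h) Φ : SchwartzBruhat (Fin Nd → v.adicCompletion (Fp L))) :
        (Fin Nd → v.adicCompletion (Fp L)) → ℂ) 0 :=
  rfl

/-- `Φ ↦ f_Φ(h)` is additive. [cite: KudlaRallis1994, §1] -/
theorem swSectionLoc_add (v : HeightOneSpectrum (𝓞 (Fp L)))
    (s : UnitaryGroup.localPi L (IsCMField.complexConj L) Nd J v →* LocalMp (Fp L) Nd T v) (m₀ : LocalMp (Fp L) Nd T v)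
    (Φ Ψ : SchwartzBruhat (Fin Nd → v.adicCompletion (Fp L))) (h : UnitaryGroup.localPi L (IsCMField.complexConj L) Nd J v) :
    swSectionLoc L v s m₀ (Φ + Ψ) h = swSectionLoc L v s m₀ Φ h + swSectionLoc L v s m₀ Ψ h := by
  unfold swSectionLoc
  rw [map_add]
  rfl

/-- `Φ ↦ f_Φ(h)` is homogeneous. [cite: KudlaRallis1994, §1] -/
theorem swSectionLoc_smul (v : HeightOneSpectrum (𝓞 (Fp L)))
    (s : UnitaryGroup.localPi L (IsCMField.complexConj L) Nd J v →* LocalMp (Fp L) Nd T v) (m₀ : LocalMp (Fp L) Nd T v)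
    (a : ℂ) (Φ : SchwartzBruhat (Fin Nd → v.adicCompletion (Fp L))) (h : UnitaryGroup.localPi L (IsCMField.complexConj L) Nd J v) :
    swSectionLoc L v s m₀ (a • Φ) h = a * swSectionLoc L v s m₀ Φ h := by
  unfold swSectionLoc
  rw [map_smul]
  rfl

/-- `Φ ↦ f_Φ(h)` kills `0`. [cite: KudlaRallis1994, §1] -/
theorem swSectionLoc_zero (v : HeightOneSpectrum (𝓞 (Fp L)))
    (s : UnitaryGroup.localPi L (IsCMField.complexConj L) Nd J v →* LocalMp (Fp L) Nd T v) (m₀ : LocalMp (Fp L) Nd T v)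
    (h : UnitaryGroup.localPi L (IsCMField.complexConj L) Nd J v) :
    swSectionLoc L v s m₀ 0 h = 0 := by
  unfold swSectionLoc
  rw [map_zero]
  rfl

set_option maxHeartbeats 800000 in -- the metaplectic pair carrier `MpPsi (localSchrodinger …)` unfolds slowly (cf. ★ `SiegelWeilSectionLine`: 2 000 000)
/-- **right translation law `f_Φ(h k) = f_{ω(s k) Φ}(h)`** — the `U(J)(L⁺_v)`-equivariance of `Φ ↦ f_Φ` (in particular the `K`-finiteness of `f_Φ` for
`K`-finite `Φ`). [cite: KudlaRallis1994, §1] [cite: HarrisKudlaSweet1996, §1 (1.8)] -/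
theorem swSectionLoc_mul_right (v : HeightOneSpectrum (𝓞 (Fp L)))
    (s : UnitaryGroup.localPi L (IsCMField.complexConj L) Nd J v →* LocalMp (Fp L) Nd T v) (m₀ : LocalMp (Fp L) Nd T v)
    (Φ : SchwartzBruhat (Fin Nd → v.adicCompletion (Fp L))) (h k : UnitaryGroup.localPi L (IsCMField.complexConj L) Nd J v) :
    swSectionLoc L v s m₀ Φ (h * k) = swSectionLoc L v s m₀ (MpPsi.toRep (localSchrodinger (Fp L) Nd T v) (s k) Φ) h := by
  unfold swSectionLoc
  rw [MonoidHom.map_mul s h k, ← mul_assoc, MonoidHom.map_mul (MpPsi.toRep (localSchrodinger (Fp L) Nd T v)) (m₀ * s h) (s k)]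
  rfl

end SW

/-! ## §3 The `V′`-Siegel–Weil section on `U(𝔻)(L⁺_v)` -/

section Tensor

variable {T : Matrix (Fin (n' + n')) (Fin (n' + n')) (Fp L)}

/-- **`swSectionTensorLoc := swSectionLoc ∘ tensorEmbLoc`** — the Siegel–Weil section of `Φ ∈ 𝒮(V′_v^{⊕n})` (the Schrödinger model of the BIG doubled datum
`𝔻 ⊗ V′` at `v`) read on `U(𝔻)(L⁺_v)` along `h ↦ h ⊗ 1_{V′}` — the place-`v` twin of the adelic ★ `swSectionTensor = swSection ∘ tensorEmb`; for Kudla's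
datum it lies in `I_v((M₂ − n)/2, χ^{M₂})` (`= I_v(½, χ³)` for `n = 2`, `M₂ = 3`). [cite: KudlaRallis1994, §1] [cite: GanQiuTakeda2014, §5.4]
[cite: HarrisKudlaSweet1996, §1 (1.15)–(1.16)] -/
def swSectionTensorLoc (v : HeightOneSpectrum (𝓞 (Fp L)))
    (sB : UnitaryGroup.localPi L (IsCMField.complexConj L) (n' + n')
        (hermD L e' dV hdV (tensorFrame L dW eW dV') (tensorFrame_real L dW hdW eW dV' hdV')) v →* LocalMp (Fp L) (n' + n') T v)
    (m₀ : LocalMp (Fp L) (n' + n') T v) (Φ : SchwartzBruhat (Fin (n' + n') → v.adicCompletion (Fp L)))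
    (h : UnitaryGroup.localPi L (IsCMField.complexConj L) (n + n) (hermD L e dV hdV dW hdW) v) : ℂ :=
  swSectionLoc L v sB m₀ Φ (tensorEmbLoc L e dV hdV dW hdW eW e' dV' hdV' v h)

/-- unfolding: `swSectionTensorLoc … h = swSectionLoc … (tensorEmbLoc v h)`. [cite: KudlaRallis1994, §1] -/
theorem swSectionTensorLoc_apply (v : HeightOneSpectrum (𝓞 (Fp L)))
    (sB : UnitaryGroup.localPi L (IsCMField.complexConj L) (n' + n')
        (hermD L e' dV hdV (tensorFrame L dW eW dV') (tensorFrame_real L dW hdW eW dV' hdV')) v →* LocalMp (Fp L) (n' + n') T v)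
    (m₀ : LocalMp (Fp L) (n' + n') T v) (Φ : SchwartzBruhat (Fin (n' + n') → v.adicCompletion (Fp L)))
    (h : UnitaryGroup.localPi L (IsCMField.complexConj L) (n + n) (hermD L e dV hdV dW hdW) v) :
    swSectionTensorLoc L e dV hdV dW hdW eW e' dV' hdV' v sB m₀ Φ h =
      swSectionLoc L v sB m₀ Φ (tensorEmbLoc L e dV hdV dW hdW eW e' dV' hdV' v h) :=
  rfl

/-- `Φ ↦ swSectionTensorLoc … Φ h` is additive. [cite: KudlaRallis1994, §1] -/
theorem swSectionTensorLoc_add (v : HeightOneSpectrum (𝓞 (Fp L)))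
    (sB : UnitaryGroup.localPi L (IsCMField.complexConj L) (n' + n')
        (hermD L e' dV hdV (tensorFrame L dW eW dV') (tensorFrame_real L dW hdW eW dV' hdV')) v →* LocalMp (Fp L) (n' + n') T v)
    (m₀ : LocalMp (Fp L) (n' + n') T v) (Φ Ψ : SchwartzBruhat (Fin (n' + n') → v.adicCompletion (Fp L)))
    (h : UnitaryGroup.localPi L (IsCMField.complexConj L) (n + n) (hermD L e dV hdV dW hdW) v) :
    swSectionTensorLoc L e dV hdV dW hdW eW e' dV' hdV' v sB m₀ (Φ + Ψ) h =
      swSectionTensorLoc L e dV hdV dW hdW eW e' dV' hdV' v sB m₀ Φ h + swSectionTensorLoc L e dV hdV dW hdW eW e' dV' hdV' v sB m₀ Ψ h :=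
  swSectionLoc_add L v sB m₀ Φ Ψ _

/-- `Φ ↦ swSectionTensorLoc … Φ h` is homogeneous. [cite: KudlaRallis1994, §1] -/
theorem swSectionTensorLoc_smul (v : HeightOneSpectrum (𝓞 (Fp L)))
    (sB : UnitaryGroup.localPi L (IsCMField.complexConj L) (n' + n')
        (hermD L e' dV hdV (tensorFrame L dW eW dV') (tensorFrame_real L dW hdW eW dV' hdV')) v →* LocalMp (Fp L) (n' + n') T v)
    (m₀ : LocalMp (Fp L) (n' + n') T v) (a : ℂ) (Φ : SchwartzBruhat (Fin (n' + n') → v.adicCompletion (Fp L)))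
    (h : UnitaryGroup.localPi L (IsCMField.complexConj L) (n + n) (hermD L e dV hdV dW hdW) v) :
    swSectionTensorLoc L e dV hdV dW hdW eW e' dV' hdV' v sB m₀ (a • Φ) h = a * swSectionTensorLoc L e dV hdV dW hdW eW e' dV' hdV' v sB m₀ Φ h :=
  swSectionLoc_smul L v sB m₀ a Φ _

/-- **right translation law on `U(𝔻)(L⁺_v)`**: `F_Φ(h k) = F_{ω(sB (k ⊗ 1)) Φ}(h)`. [cite: KudlaRallis1994, §1] [cite: HarrisKudlaSweet1996, §1 (1.8)] -/
theorem swSectionTensorLoc_mul_right (v : HeightOneSpectrum (𝓞 (Fp L)))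
    (sB : UnitaryGroup.localPi L (IsCMField.complexConj L) (n' + n')
        (hermD L e' dV hdV (tensorFrame L dW eW dV') (tensorFrame_real L dW hdW eW dV' hdV')) v →* LocalMp (Fp L) (n' + n') T v)
    (m₀ : LocalMp (Fp L) (n' + n') T v) (Φ : SchwartzBruhat (Fin (n' + n') → v.adicCompletion (Fp L)))
    (h k : UnitaryGroup.localPi L (IsCMField.complexConj L) (n + n) (hermD L e dV hdV dW hdW) v) :
    swSectionTensorLoc L e dV hdV dW hdW eW e' dV' hdV' v sB m₀ Φ (h * k) =
      swSectionTensorLoc L e dV hdV dW hdW eW e' dV' hdV' v sB m₀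
        (MpPsi.toRep (localSchrodinger (Fp L) (n' + n') T v) (sB (tensorEmbLoc L e dV hdV dW hdW eW e' dV' hdV' v k)) Φ) h := by
  unfold swSectionTensorLoc
  rw [MonoidHom.map_mul (tensorEmbLoc L e dV hdV dW hdW eW e' dV' hdV' v) h k]
  exact swSectionLoc_mul_right L v sB m₀ Φ _ _

end Tensor

end Summit.HodgeConjecture.HodgeConjecture.Cruxes.HLiu418.K2LiuLocalSWSectionDefs

end
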